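import Summits.AnomalousDissipation.AnomalousDissipation.Theorems.SawtoothPulseCascadeK1LocalisedCascadePhaseOneTails

/-!
# K1loc, line `Spectral` / thin start — helper: THE H-ENERGY TAIL OF THE PHASE-ONE ITERATE BEYOND `|k₀| > 400` («PhaseOneHTail»)

Helper file of the prover lane on the crux `K1LocalisedCascade` (stmt-AnomalousDissipation-19491), route `SawtoothPulseCascade`
(glue seat; plan `PHASE1-DIRECT-SIZING-k1locp3g4.md` §4, D7 inputs).  The explicit per-fibre treatment of the T-H junk stops at
`|k₀| = 400`; beyond, the junk is dominated by the whole H-energy of `a₁` there: `τ := Σ'_k [|k₀| ≥ 401]‖𝓕a₁(k)‖²`.  By the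
phase-one start inequality with exact weights (`…PhaseOneStart.tsum_weight_sq_norm_phaseOne_le_exact`, weight `W = [|k₀| ≥ 401]`) the
fibre functionals are tail masses of the rounded chirps `ĝ_n` beyond `|m| ≥ 400` (`≤ T(8n,400) + 2|n|·2⁻²⁵` for `|n| ≤ 49` by
`…PhaseOneTails.tsum_tail_sq_norm_twist_le`, `≤ 1` always) against the SHARP exact-chirp weights `‖ĝ₀^{±8}(n)‖²` (`¼` at `n = ±8`,
`(16/(π(n²−64)))²` at odd `n`, `0` at even `n ≠ ±8`), whose own tail beyond `|n| ≥ 50` is `T(8,50)`: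
* `phaseOne_chirp_near`: `‖twist ψ₀ n x − g₀^{(8n)} x‖ ≤ 2π|n|η₀ ≤ |n|·2⁻²⁵`;
* `sq_norm_fourierCoeff_exactChirp8_le`: the sharp `λ = ±8` table;
* `hTail_sum_le`: the 49-term numeric sum `≤ 25/10⁶`;
* **`phaseOne_hTail_le`**: `τ ≤ 181/10⁶`.
No definitions; nothing about the crux. [cite: Grafakos2014, Prop. 3.1.2 (5), Prop. 3.2.7 (3)] [problem: turb]
-/

-- `Summit.<Summit>.<Problem>`: single-conjunct summit, the duplicate namespace segment is deliberate.
set_option linter.dupNamespace false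

noncomputable section

namespace Summit.AnomalousDissipation.AnomalousDissipation.Theorems.SawtoothPulseCascade.K1Start

open MeasureTheory Filter Topology UnitAddTorus Complex AddCircle
open scoped Real
open Literature.Analysis Literature.Analysis.FunctionSpaces Literature.Analysis.FunctionSpaces.Torus Literature.Analysis.FluidPDE
open Literature.Analysis.FluidPDE.ShearStage
open Literature.Analysis.FluidPDE.SawtoothCascade Literature.Analysis.FluidPDE.SawtoothCascade.CascadeParams
open Summit.AnomalousDissipation.AnomalousDissipation.Theorems.SawtoothPulseCascade.K1Window

/-! ## §1 The rounded phase-0 chirp of fibre `n` next to the exact chirp of lobe `8n` -/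

/-- **Pointwise nearness**: `|ψ − 8·tri(2π·)/(2π)| ≤ η` ⇒ `‖twist ψ n x − g₀^{(8n)} x‖ ≤ 2π|n|η`. [folklore] -/
theorem norm_twist_sub_exactChirp_le (ψ : ShearProfile) {η : ℝ}
    (hη : ∀ t : ℝ, |ψ t - (8 : ℤ) * (tri (2 * π * t) / (2 * π))| ≤ η) (n : ℤ) {g₀ : UnitAddCircle → ℂ}
    (hg₀ : ∀ t : ℝ, g₀ (t : UnitAddCircle) = Complex.exp (-(2 * π * I * ((8 * n : ℤ)) * ((tri (2 * π * t) / (2 * π) : ℝ) : ℂ))))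
    (x : UnitAddCircle) : ‖twist ψ n x - g₀ x‖ ≤ 2 * π * (|(n : ℝ)| * η) := by
  obtain ⟨t, rfl⟩ := QuotientAddGroup.mk_surjective x
  rw [show (QuotientAddGroup.mk t : UnitAddCircle) = ((t : ℝ) : UnitAddCircle) from rfl, twist_coe, hg₀ t]
  have h := norm_exp_neg_two_pi_I_sub_le (n * ψ t) (((8 * n : ℤ) : ℝ) * (tri (2 * π * t) / (2 * π)))
  have e1 : Complex.exp (-(2 * π * I * ((n * ψ t : ℝ) : ℂ))) = Complex.exp (-(2 * Real.pi * Complex.I * n * ψ t)) := by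
    congr 1; push_cast; ring
  have e2 : Complex.exp (-(2 * π * I * (((((8 * n : ℤ) : ℝ) * (tri (2 * π * t) / (2 * π))) : ℝ) : ℂ))) =
      Complex.exp (-(2 * π * I * ((8 * n : ℤ)) * ((tri (2 * π * t) / (2 * π) : ℝ) : ℂ))) := by
    congr 1; push_cast; ring
  rw [e1, e2] at h
  have hq : |n * ψ t - ((8 * n : ℤ) : ℝ) * (tri (2 * π * t) / (2 * π))| ≤ |(n : ℝ)| * η := by
    rw [show (n : ℝ) * ψ t - ((8 * n : ℤ) : ℝ) * (tri (2 * π * t) / (2 * π)) =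
      n * (ψ t - ((8 : ℤ) : ℝ) * (tri (2 * π * t) / (2 * π))) by push_cast; ring, abs_mul]
    exact mul_le_mul_of_nonneg_left (hη t) (abs_nonneg _)
  exact h.trans (by nlinarith [Real.pi_pos, abs_nonneg (n * ψ t - ((8 * n : ℤ) : ℝ) * (tri (2 * π * t) / (2 * π)))])

/-- **The sharp `λ = ±8` table, squared**: for the exact chirp of lobe `±8`, `‖ĝ₀(n)‖² ≤ w₈(n)` with `w₈(±8) = ¼`, `w₈(n) = 0` for even
`n ≠ ±8`, `w₈(n) = (16·0.31831/|n² − 64|)²` for odd `n`. [cite: Grafakos2014, Prop. 3.1.2 (5)] -/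
theorem sq_norm_fourierCoeff_exactChirp8_le {lam : ℤ} (hl : lam = 8 ∨ lam = -8) {g₀ : UnitAddCircle → ℂ}
    (hg₀ : ∀ t : ℝ, g₀ (t : UnitAddCircle) = Complex.exp (-(2 * π * I * lam * ((tri (2 * π * t) / (2 * π) : ℝ) : ℂ))))
    (hg₀c : Continuous g₀) (n : ℤ) :
    ‖fourierCoeff g₀ n‖ ^ 2 ≤
      (if n = 8 ∨ n = -8 then (1 / 4 : ℝ) else if n % 2 = 0 then 0 else (16 * 0.31831 / |(n : ℝ) ^ 2 - 64|) ^ 2) := by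
  have hlam : lam ≠ 0 := by rcases hl with rfl | rfl <;> norm_num
  split_ifs with h8 hev
  · have hself := norm_fourierCoeff_exactChirp_self_le hlam hg₀ hg₀c
    have hb : ‖fourierCoeff g₀ n‖ ≤ 1 / 2 := by
      rcases hl with rfl | rfl <;> rcases h8 with rfl | rfl
      · exact hself.2
      · exact hself.1
      · simpa using hself.1
      · exact hself.2
    nlinarith [norm_nonneg (fourierCoeff g₀ n)]
  · rw [not_or] at h8
    have hev' : Even (lam + n) := by rw [Int.even_iff]; rcases hl with rfl | rfl <;> omega
    rw [fourierCoeff_exactChirp_eq_zero_of_even hg₀ hg₀c hev' (by rcases hl with rfl | rfl <;> omega)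
      (by rcases hl with rfl | rfl <;> omega), norm_zero]
    norm_num
  · rw [not_or] at h8
    have h1 := norm_fourierCoeff_oneTooth_le_sharp lam hg₀ (m := n) (by rcases hl with rfl | rfl <;> omega)
      (by rcases hl with rfl | rfl <;> omega)
    have hl2 : (lam : ℝ) ^ 2 = 64 := by rcases hl with rfl | rfl <;> norm_num
    have hla : |(lam : ℝ)| = 8 := by rcases hl with rfl | rfl <;> norm_num
    rw [hl2, hla] at h1
    have hne : (n : ℝ) ^ 2 - 64 ≠ 0 := by
      intro h
      have : ((n ^ 2 : ℤ) : ℝ) = ((64 : ℤ) : ℝ) := by push_cast; linarith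
      have h2 : n ^ 2 = 64 := by exact_mod_cast this
      have : (n - 8) * (n + 8) = 0 := by ring_nf; linarith
      rcases mul_eq_zero.1 this with h3 | h3 <;> omega
    have hpos : 0 < |(n : ℝ) ^ 2 - 64| := abs_pos.2 hne
    have h2 : 2 * 8 / (π * |64 - (n : ℝ) ^ 2|) ≤ 16 * 0.31831 / |(n : ℝ) ^ 2 - 64| := by
      rw [abs_sub_comm, div_le_div_iff₀ (by positivity) hpos]
      have hϖ := inv_pi_le_d5
      have h3 : (1 : ℝ) ≤ 0.31831 * π := by
        have := (div_le_iff₀ Real.pi_pos).1 hϖ; linarith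
      nlinarith [hpos]
    exact pow_le_pow_left₀ (norm_nonneg _) (h1.trans h2) 2

/-! ## §2 The numeric sum -/

/-- **The 49-term sum**: `2·Σ_{n=1}^{49} w₈(n)·(T(8n,400) + 2n·2⁻²⁵) ≤ 25/10⁶`. [folklore] -/
theorem hTail_sum_le :
    2 * ∑ i ∈ Finset.range 49,
      (if ((i : ℤ) + 1) = 8 ∨ ((i : ℤ) + 1) = -8 then (1 / 4 : ℝ) else if ((i : ℤ) + 1) % 2 = 0 then 0
        else (16 * 0.31831 / |((((i : ℤ) + 1 : ℤ)) : ℝ) ^ 2 - 64|) ^ 2) *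
      (2 * (2 * |(((8 * ((i : ℤ) + 1) : ℤ)) : ℝ)| * 0.31831) ^ 2 *
          (((400 : ℕ) : ℝ) ^ 2 / (((400 : ℕ) : ℝ) ^ 2 - (((8 * ((i : ℤ) + 1) : ℤ)) : ℝ) ^ 2)) ^ 2 /
          (3 * (((400 : ℕ) : ℝ) - 2) * (((400 : ℕ) : ℝ) - 1) * ((400 : ℕ) : ℝ)) +
        2 * (2 * π * (|((((i : ℤ) + 1 : ℤ)) : ℝ)| * (8 * ((2 * Real.exp (1 / 2) - 1) * ((2 : ℝ)⁻¹ ^ 30) / (2 * π)))))) ≤ 25 / 10 ^ 6 := by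
  have hπ : (π : ℝ) ≠ 0 := Real.pi_pos.ne'
  have he : Real.exp (1 / 2) ≤ 5 / 3 := by
    have h1 : Real.exp (1 / 2) * Real.exp (1 / 2) = Real.exp 1 := by rw [← Real.exp_add]; norm_num
    have h2 := Real.exp_one_lt_d9
    have h0 : 0 < Real.exp (1 / 2) := Real.exp_pos _
    nlinarith
  have hround : ∀ x : ℝ, 0 ≤ x → 2 * (2 * π * (x * (8 * ((2 * Real.exp (1 / 2) - 1) * ((2 : ℝ)⁻¹ ^ 30) / (2 * π))))) ≤
      2 * (x * (2 : ℝ)⁻¹ ^ 25) := by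
    intro x hx
    have e : 2 * (2 * π * (x * (8 * ((2 * Real.exp (1 / 2) - 1) * ((2 : ℝ)⁻¹ ^ 30) / (2 * π))))) =
        2 * (x * (8 * (2 * Real.exp (1 / 2) - 1) * (2 : ℝ)⁻¹ ^ 30)) := by field_simp
    rw [e]
    have h1 := rounding_slope_le (δ₀ := (2 : ℝ)⁻¹ ^ 30) (by positivity) le_rfl
    nlinarith
  -- replace the rounding term by `2·x·2⁻²⁵` termwise, then evaluate
  have hterm : ∀ i ∈ Finset.range 49,
      (if ((i : ℤ) + 1) = 8 ∨ ((i : ℤ) + 1) = -8 then (1 / 4 : ℝ) else if ((i : ℤ) + 1) % 2 = 0 then 0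
        else (16 * 0.31831 / |((((i : ℤ) + 1 : ℤ)) : ℝ) ^ 2 - 64|) ^ 2) *
      (2 * (2 * |(((8 * ((i : ℤ) + 1) : ℤ)) : ℝ)| * 0.31831) ^ 2 *
          (((400 : ℕ) : ℝ) ^ 2 / (((400 : ℕ) : ℝ) ^ 2 - (((8 * ((i : ℤ) + 1) : ℤ)) : ℝ) ^ 2)) ^ 2 /
          (3 * (((400 : ℕ) : ℝ) - 2) * (((400 : ℕ) : ℝ) - 1) * ((400 : ℕ) : ℝ)) +
        2 * (2 * π * (|((((i : ℤ) + 1 : ℤ)) : ℝ)| * (8 * ((2 * Real.exp (1 / 2) - 1) * ((2 : ℝ)⁻¹ ^ 30) / (2 * π)))))) ≤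
      (if ((i : ℤ) + 1) = 8 ∨ ((i : ℤ) + 1) = -8 then (1 / 4 : ℝ) else if ((i : ℤ) + 1) % 2 = 0 then 0
        else (16 * 0.31831 / |((((i : ℤ) + 1 : ℤ)) : ℝ) ^ 2 - 64|) ^ 2) *
      (2 * (2 * |(((8 * ((i : ℤ) + 1) : ℤ)) : ℝ)| * 0.31831) ^ 2 *
          (((400 : ℕ) : ℝ) ^ 2 / (((400 : ℕ) : ℝ) ^ 2 - (((8 * ((i : ℤ) + 1) : ℤ)) : ℝ) ^ 2)) ^ 2 /
          (3 * (((400 : ℕ) : ℝ) - 2) * (((400 : ℕ) : ℝ) - 1) * ((400 : ℕ) : ℝ)) +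
        2 * (|((((i : ℤ) + 1 : ℤ)) : ℝ)| * (2 : ℝ)⁻¹ ^ 25)) := by
    intro i _
    have hw : 0 ≤ (if ((i : ℤ) + 1) = 8 ∨ ((i : ℤ) + 1) = -8 then (1 / 4 : ℝ) else if ((i : ℤ) + 1) % 2 = 0 then 0
        else (16 * 0.31831 / |((((i : ℤ) + 1 : ℤ)) : ℝ) ^ 2 - 64|) ^ 2) := by split_ifs <;> positivity
    exact mul_le_mul_of_nonneg_left (add_le_add le_rfl (hround _ (abs_nonneg _))) hw
  refine (mul_le_mul_of_nonneg_left (Finset.sum_le_sum hterm) (by norm_num)).trans ?_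
  simp only [Finset.sum_range_succ, Finset.sum_range_zero]
  norm_num

/-! ## §3 The exact-chirp functional against tail-type fibre weights -/

/-- **The `λ = ±8` exact chirp against fibre functionals of tail type**: if `0 ≤ Φ ≤ 1` and
`Φ(n) ≤ T(8n,400) + 2·2π|n|η₁` for `1 ≤ |n| ≤ 49` (`η₁` the rounding width at `δ₀ = 2⁻³⁰`), then
`Σ'_n ‖ĝ₀(n)‖²Φ(n) ≤ 25/10⁶ + T(8,50) ≤ 180/10⁶`. [cite: Grafakos2014, Prop. 3.1.2 (5), Prop. 3.2.7 (3)] -/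
theorem exactChirp8_functional_le {lam : ℤ} (hl : lam = 8 ∨ lam = -8) {g : UnitAddCircle → ℂ}
    (hg : ∀ t : ℝ, g (t : UnitAddCircle) = Complex.exp (-(2 * π * I * lam * ((tri (2 * π * t) / (2 * π) : ℝ) : ℂ))))
    (hgc : Continuous g) {Φ : ℤ → ℝ} (hΦ0 : ∀ n, 0 ≤ Φ n) (hΦ1 : ∀ n, Φ n ≤ 1)
    (hΦT : ∀ n : ℤ, 1 ≤ |n| → |n| ≤ 49 → Φ n ≤
      2 * (2 * |(((8 * n : ℤ)) : ℝ)| * 0.31831) ^ 2 * (((400 : ℕ) : ℝ) ^ 2 / (((400 : ℕ) : ℝ) ^ 2 - (((8 * n : ℤ)) : ℝ) ^ 2)) ^ 2 /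
          (3 * (((400 : ℕ) : ℝ) - 2) * (((400 : ℕ) : ℝ) - 1) * ((400 : ℕ) : ℝ)) +
        2 * (2 * π * (|(n : ℝ)| * (8 * ((2 * Real.exp (1 / 2) - 1) * ((2 : ℝ)⁻¹ ^ 30) / (2 * π)))))) :
    ∑' n : ℤ, ‖fourierCoeff g n‖ ^ 2 * Φ n ≤ 180 / 10 ^ 6 := by
  have hπ : 0 < π := Real.pi_pos
  have hPg := hasSum_sq_norm_fourierCoeff_exactChirp hg hgc
  -- the folded table term
  have hwTneg : ∀ n : ℤ, (fun n : ℤ =>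
      (if n = 8 ∨ n = -8 then (1 / 4 : ℝ) else if n % 2 = 0 then 0 else (16 * 0.31831 / |(n : ℝ) ^ 2 - 64|) ^ 2) *
        (2 * (2 * |(((8 * n : ℤ)) : ℝ)| * 0.31831) ^ 2 * (((400 : ℕ) : ℝ) ^ 2 / (((400 : ℕ) : ℝ) ^ 2 - (((8 * n : ℤ)) : ℝ) ^ 2)) ^ 2 /
            (3 * (((400 : ℕ) : ℝ) - 2) * (((400 : ℕ) : ℝ) - 1) * ((400 : ℕ) : ℝ)) +
          2 * (2 * π * (|(n : ℝ)| * (8 * ((2 * Real.exp (1 / 2) - 1) * ((2 : ℝ)⁻¹ ^ 30) / (2 * π))))))) (-n) =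
      (fun n : ℤ =>
      (if n = 8 ∨ n = -8 then (1 / 4 : ℝ) else if n % 2 = 0 then 0 else (16 * 0.31831 / |(n : ℝ) ^ 2 - 64|) ^ 2) *
        (2 * (2 * |(((8 * n : ℤ)) : ℝ)| * 0.31831) ^ 2 * (((400 : ℕ) : ℝ) ^ 2 / (((400 : ℕ) : ℝ) ^ 2 - (((8 * n : ℤ)) : ℝ) ^ 2)) ^ 2 /
            (3 * (((400 : ℕ) : ℝ) - 2) * (((400 : ℕ) : ℝ) - 1) * ((400 : ℕ) : ℝ)) +
          2 * (2 * π * (|(n : ℝ)| * (8 * ((2 * Real.exp (1 / 2) - 1) * ((2 : ℝ)⁻¹ ^ 30) / (2 * π))))))) n := by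
    intro n
    have e1 : (-n = 8 ∨ -n = -8) ↔ (n = 8 ∨ n = -8) := by omega
    have e2 : ((-n) % 2 = 0) ↔ (n % 2 = 0) := by omega
    have e3 : ((-n : ℤ) : ℝ) ^ 2 = (n : ℝ) ^ 2 := by push_cast; ring
    have e4 : |((-n : ℤ) : ℝ)| = |(n : ℝ)| := by push_cast; rw [abs_neg]
    have e5 : |(((8 * -n : ℤ)) : ℝ)| = |(((8 * n : ℤ)) : ℝ)| := by push_cast; rw [mul_neg, abs_neg]
    have e6 : (((8 * -n : ℤ)) : ℝ) ^ 2 = (((8 * n : ℤ)) : ℝ) ^ 2 := by push_cast; ring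
    simp only [e1, e2, e3, e4, e5, e6]
  set wT : ℤ → ℝ := fun n : ℤ =>
      (if n = 8 ∨ n = -8 then (1 / 4 : ℝ) else if n % 2 = 0 then 0 else (16 * 0.31831 / |(n : ℝ) ^ 2 - 64|) ^ 2) *
        (2 * (2 * |(((8 * n : ℤ)) : ℝ)| * 0.31831) ^ 2 * (((400 : ℕ) : ℝ) ^ 2 / (((400 : ℕ) : ℝ) ^ 2 - (((8 * n : ℤ)) : ℝ) ^ 2)) ^ 2 /
            (3 * (((400 : ℕ) : ℝ) - 2) * (((400 : ℕ) : ℝ) - 1) * ((400 : ℕ) : ℝ)) +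
          2 * (2 * π * (|(n : ℝ)| * (8 * ((2 * Real.exp (1 / 2) - 1) * ((2 : ℝ)⁻¹ ^ 30) / (2 * π)))))) with hwT
  have hnum : 2 * ∑ i ∈ Finset.range 49, wT ((i : ℤ) + 1) ≤ 25 / 10 ^ 6 := hTail_sum_le
  set F : Finset ℤ := Finset.Icc (-49 : ℤ) 49 with hF
  have hfold : ∑ n ∈ F, (if n = 0 then (0 : ℝ) else wT n) = 2 * ∑ i ∈ Finset.range 49, wT ((i : ℤ) + 1) := by
    have hsplit : F = insert 0 (Finset.Icc (1 : ℤ) 49 ∪ (Finset.Icc (1 : ℤ) 49).image (fun n => -n)) := by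
      ext n
      rw [hF, Finset.mem_Icc, Finset.mem_insert, Finset.mem_union, Finset.mem_Icc, Finset.mem_image]
      constructor
      · rintro ⟨h1, h2⟩
        by_cases h0 : n = 0
        · exact Or.inl h0
        · right
          rcases lt_or_gt_of_ne h0 with hn | hn
          · right; exact ⟨-n, Finset.mem_Icc.2 ⟨by omega, by omega⟩, by omega⟩
          · left; exact ⟨by omega, h2⟩
      · rintro (h | ⟨h1, h2⟩ | ⟨m, hm, hmn⟩)
        · rw [h]; norm_num
        · exact ⟨by omega, h2⟩
        · rw [Finset.mem_Icc] at hm; omega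
    have hdisj : Disjoint (Finset.Icc (1 : ℤ) 49) ((Finset.Icc (1 : ℤ) 49).image (fun n => -n)) := by
      rw [Finset.disjoint_left]; intro n hn hn'
      rw [Finset.mem_Icc] at hn; rw [Finset.mem_image] at hn'
      obtain ⟨m, hm, rfl⟩ := hn'; rw [Finset.mem_Icc] at hm; omega
    have h0mem : (0 : ℤ) ∉ Finset.Icc (1 : ℤ) 49 ∪ (Finset.Icc (1 : ℤ) 49).image (fun n => -n) := by
      rw [Finset.mem_union, Finset.mem_Icc, Finset.mem_image, not_or]
      exact ⟨by omega, fun ⟨m, hm, hm0⟩ => by rw [Finset.mem_Icc] at hm; omega⟩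
    rw [hsplit, Finset.sum_insert h0mem, if_pos rfl, zero_add, Finset.sum_union hdisj,
      Finset.sum_image fun a _ b _ h => by simpa using h]
    have e1 : ∑ n ∈ Finset.Icc (1 : ℤ) 49, (if n = 0 then (0 : ℝ) else wT n) = ∑ n ∈ Finset.Icc (1 : ℤ) 49, wT n :=
      Finset.sum_congr rfl fun n hn => by rw [Finset.mem_Icc] at hn; rw [if_neg (by omega)]
    have e2 : ∑ n ∈ Finset.Icc (1 : ℤ) 49, (if -n = 0 then (0 : ℝ) else wT (-n)) = ∑ n ∈ Finset.Icc (1 : ℤ) 49, wT n :=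
      Finset.sum_congr rfl fun n hn => by rw [Finset.mem_Icc] at hn; rw [if_neg (by omega)]; exact hwTneg n
    have e3 := sum_Icc_one_eq_sum_range wT 49
    push_cast at e3
    rw [e1, e2, e3]
    ring
  -- termwise majorant and summation
  set maj : ℤ → ℝ := fun n => (if n ∈ F then (if n = 0 then 0 else wT n) else 0) +
    (if ((50 : ℕ) : ℤ) ≤ |n| then ‖fourierCoeff g n‖ ^ 2 else 0) with hmaj
  have hle : ∀ n, ‖fourierCoeff g n‖ ^ 2 * Φ n ≤ maj n := by
    intro n
    simp only [hmaj]
    by_cases hnF : n ∈ F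
    · rw [if_pos hnF]
      have hn49 : |n| ≤ 49 := by rw [hF, Finset.mem_Icc] at hnF; rw [abs_le]; exact hnF
      have hn50 : ¬ ((50 : ℕ) : ℤ) ≤ |n| := by push_cast; omega
      rw [if_neg hn50, add_zero]
      by_cases hn0 : n = 0
      · rw [if_pos hn0, hn0]
        have h00 : fourierCoeff g 0 = 0 :=
          fourierCoeff_exactChirp_eq_zero_of_even hg hgc (by rcases hl with rfl | rfl <;> decide)
            (by rcases hl with rfl | rfl <;> decide) (by rcases hl with rfl | rfl <;> decide)
        rw [h00]; simp
      · rw [if_neg hn0]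
        have hn1 : 1 ≤ |n| := Int.one_le_abs hn0
        have hw := sq_norm_fourierCoeff_exactChirp8_le hl hg hgc n
        have hT := hΦT n hn1 hn49
        have hw0 : 0 ≤ (if n = 8 ∨ n = -8 then (1 / 4 : ℝ) else if n % 2 = 0 then 0 else (16 * 0.31831 / |(n : ℝ) ^ 2 - 64|) ^ 2) := by
          split_ifs <;> positivity
        exact mul_le_mul hw hT (hΦ0 n) hw0
    · rw [if_neg hnF, zero_add]
      have hn50 : ((50 : ℕ) : ℤ) ≤ |n| := by
        rw [hF, Finset.mem_Icc, not_and_or, not_le, not_le] at hnF; push_cast; rw [le_abs]; omega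
      rw [if_pos hn50]
      exact mul_le_of_le_one_right (sq_nonneg _) (hΦ1 n)
  have hs1 : Summable fun n => (if n ∈ F then (if n = 0 then (0 : ℝ) else wT n) else 0) :=
    summable_of_ne_finset_zero (s := F) fun n hn => if_neg hn
  have hs2 : Summable fun n => (if ((50 : ℕ) : ℤ) ≤ |n| then ‖fourierCoeff g n‖ ^ 2 else 0) :=
    Summable.of_nonneg_of_le (fun n => by split_ifs <;> positivity) (fun n => by split_ifs <;> simp) hPg.summable
  have hsmaj : Summable maj := hs1.add hs2
  have hf0 : ∀ n, 0 ≤ ‖fourierCoeff g n‖ ^ 2 * Φ n := fun n => mul_nonneg (sq_nonneg _) (hΦ0 n)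
  have hsf : Summable fun n => ‖fourierCoeff g n‖ ^ 2 * Φ n := Summable.of_nonneg_of_le hf0 hle hsmaj
  have h1 := Summable.tsum_le_tsum hle hsf hsmaj
  have h2 : ∑' n, maj n = ∑ n ∈ F, (if n = 0 then (0 : ℝ) else wT n) +
      ∑' n, (if ((50 : ℕ) : ℤ) ≤ |n| then ‖fourierCoeff g n‖ ^ 2 else 0) := by
    rw [hmaj, hs1.tsum_add hs2, tsum_eq_sum (s := F) fun n hn => if_neg hn]
    exact congrArg (fun x => x + _) (Finset.sum_congr rfl fun n hn => if_pos hn)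
  have hQ8 : |lam| < ((50 : ℕ) : ℤ) := by rcases hl with rfl | rfl <;> decide
  have h3 := tsum_tail_sq_norm_exactChirp_le hg (by norm_num) hQ8
  have hlamr : ((lam : ℤ) : ℝ) ^ 2 = ((8 : ℤ) : ℝ) ^ 2 := by rcases hl with rfl | rfl <;> push_cast <;> norm_num
  have hlama : |((lam : ℤ) : ℝ)| = |((8 : ℤ) : ℝ)| := by rcases hl with rfl | rfl <;> push_cast <;> norm_num
  rw [hlamr, hlama] at h3
  have h3' : ∑' n : ℤ, (if ((50 : ℕ) : ℤ) ≤ |n| then ‖fourierCoeff g n‖ ^ 2 else 0) ≤ 155 / 10 ^ 6 :=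
    h3.trans (by norm_num)
  rw [h2, hfold] at h1
  calc ∑' n : ℤ, ‖fourierCoeff g n‖ ^ 2 * Φ n
      ≤ 2 * ∑ i ∈ Finset.range 49, wT ((i : ℤ) + 1) +
          ∑' n : ℤ, (if ((50 : ℕ) : ℤ) ≤ |n| then ‖fourierCoeff g n‖ ^ 2 else 0) := h1
    _ ≤ 25 / 10 ^ 6 + 155 / 10 ^ 6 := add_le_add hnum h3'
    _ ≤ 180 / 10 ^ 6 := by norm_num

/-! ## §4 The H-energy tail -/

/-- **A tail-type fibre functional of the rounded chirp**: if `0 ≤ W ≤ 1` and `W(p,n) ≠ 0 ⇒ 400 ≤ |p + c|`,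
then `Σ'_p W(p,n)‖ĝ_n(p+c)‖² ≤ Σ'_m [400 ≤ |m|]‖ĝ_n(m)‖²`. [folklore] -/
theorem tsum_tailWeight_twist_shift_le (ψ : ShearProfile) (n c : ℤ) {W : (Fin 2 → ℤ) → ℝ} (hW0 : ∀ k, 0 ≤ W k)
    (hW1 : ∀ k, W k ≤ 1) (hWs : ∀ p : ℤ, W (![p, n]) ≠ 0 → ((400 : ℕ) : ℤ) ≤ |p + c|) :
    ∑' p : ℤ, W (![p, n]) * ‖fourierCoeff (twist ψ n) (p + c)‖ ^ 2 ≤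
      ∑' m : ℤ, (if ((400 : ℕ) : ℤ) ≤ |m| then ‖fourierCoeff (twist ψ n) m‖ ^ 2 else 0) := by
  have hs : Summable fun m : ℤ => (if ((400 : ℕ) : ℤ) ≤ |m| then ‖fourierCoeff (twist ψ n) m‖ ^ 2 else 0) :=
    Summable.of_nonneg_of_le (fun m => by split_ifs <;> positivity)
      (fun m => by split_ifs; exacts [le_rfl, sq_nonneg _]) (hasSum_sq_norm_fourierCoeff_twist ψ n).summable
  have hs2 : Summable fun p : ℤ => (if ((400 : ℕ) : ℤ) ≤ |p + c| then ‖fourierCoeff (twist ψ n) (p + c)‖ ^ 2 else 0) := by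
    have h := (Equiv.addRight c).summable_iff.2 hs
    simpa only [Function.comp_def, Equiv.coe_addRight] using h
  have hshift := (Equiv.addRight c).tsum_eq
    (fun m : ℤ => if ((400 : ℕ) : ℤ) ≤ |m| then ‖fourierCoeff (twist ψ n) m‖ ^ 2 else 0)
  simp only [Equiv.coe_addRight] at hshift
  rw [← hshift]
  refine Summable.tsum_le_tsum (fun p => ?_) (summable_weight_chirp ψ n c hW0 hW1) hs2
  by_cases h1 : W (![p, n]) = 0
  · rw [h1, zero_mul]
    split_ifs
    · positivity
    · exact le_rfl
  · rw [if_pos (hWs p h1)]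
    exact mul_le_of_le_one_left (sq_nonneg _) (hW1 _)

section Cascade

variable (P : CascadeParams)

/-- **THE H-ENERGY TAIL OF `a₁` BEYOND `|k₀| > 400`** (`γ = 8`, `N₀ = 1`, `0 < δ₀ ≤ 2⁻³⁰`):
`Σ'_k [|k₀| ≥ 401] ‖𝓕a₁(k)‖² ≤ 181/10⁶`. [cite: Grafakos2014, Prop. 3.1.2 (5), Prop. 3.2.7 (3)] -/
theorem phaseOne_hTail_le (hγ : P.γ = 8) (hN₀ : P.N₀ = 1) (hδ₀ : 0 < P.δ₀) (hδ₀' : P.δ₀ ≤ (2 : ℝ)⁻¹ ^ 30) (hd : 0 < P.d)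
    (a b : ℕ → UnitAddTorus (Fin 2) → ℝ) (h0 : a 0 = datum)
    (hb : b 0 = a 0 ∘ shearMap 0 1 (amp ⟨P.U 0, P.U_periodic 0, P.contDiff_U (P.δ_pos hδ₀ hd 0)⟩ P.γ))
    (hab : a 1 = b 0 ∘ shearMap 1 0 (amp ⟨P.U 0, P.U_periodic 0, P.contDiff_U (P.δ_pos hδ₀ hd 0)⟩ P.γ)) :
    ∑' k : Fin 2 → ℤ, (if (401 : ℤ) ≤ |k 0| then (1 : ℝ) else 0) * ‖mFourierCoeff (fun x => (a 1 x : ℂ)) k‖ ^ 2 ≤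
      181 / 10 ^ 6 := by
  have hπ : 0 < π := Real.pi_pos
  set ψ : ShearProfile := amp ⟨P.U 0, P.U_periodic 0, P.contDiff_U (P.δ_pos hδ₀ hd 0)⟩ P.γ with hψ
  set η : ℝ := 8 * ((2 * Real.exp (1 / 2) - 1) * P.δ₀ / (2 * π)) with hηdef
  have hη : ∀ t : ℝ, |ψ t - (8 : ℤ) * (tri (2 * π * t) / (2 * π))| ≤ η := by
    intro t
    have h := phaseZero_profile_near P hγ hN₀ hδ₀ hd 1 t
    simpa [hψ, hηdef] using h
  have hηs : 2 * π * η ≤ (2 : ℝ)⁻¹ ^ 25 := by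
    have e : 2 * π * η = 8 * (2 * Real.exp (1 / 2) - 1) * P.δ₀ := by rw [hηdef]; field_simp
    rw [e]; exact rounding_slope_le hδ₀.le hδ₀'
  have hη0 : 0 ≤ η := (abs_nonneg _).trans (hη 0)
  set η₁ : ℝ := 8 * ((2 * Real.exp (1 / 2) - 1) * ((2 : ℝ)⁻¹ ^ 30) / (2 * π)) with hη₁
  have hηη₁ : η ≤ η₁ := by
    rw [hηdef, hη₁]
    have h1 : 0 ≤ 2 * Real.exp (1 / 2) - 1 := by linarith [Real.add_one_le_exp (1 / 2 : ℝ)]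
    have h2 : (2 * Real.exp (1 / 2) - 1) * P.δ₀ ≤ (2 * Real.exp (1 / 2) - 1) * (2 : ℝ)⁻¹ ^ 30 :=
      mul_le_mul_of_nonneg_left hδ₀' h1
    have h3 : (2 * Real.exp (1 / 2) - 1) * P.δ₀ / (2 * π) ≤ (2 * Real.exp (1 / 2) - 1) * (2 : ℝ)⁻¹ ^ 30 / (2 * π) :=
      div_le_div_of_nonneg_right h2 (by positivity)
    linarith
  rw [h0] at hb
  obtain ⟨gp, hgpc, hgp⟩ := exists_exactChirp 8
  obtain ⟨gm, hgmc, hgm⟩ := exists_exactChirp (-8)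
  set W : (Fin 2 → ℤ) → ℝ := fun k => if (401 : ℤ) ≤ |k 0| then (1 : ℝ) else 0 with hWdef
  have hW0 : ∀ k, 0 ≤ W k := fun k => by simp only [hWdef]; split_ifs <;> norm_num
  have hW1 : ∀ k, W k ≤ 1 := fun k => by simp only [hWdef]; split_ifs <;> norm_num
  have hWs : ∀ (c : ℤ), (c = 1 ∨ c = -1) → ∀ (n p : ℤ), W (![p, n]) ≠ 0 → ((400 : ℕ) : ℤ) ≤ |p + c| := by
    intro c hc n p hp
    have h401 : (401 : ℤ) ≤ |p| := by
      by_contra h; exact hp (by simp only [hWdef, Matrix.cons_val_zero, if_neg h])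
    rcases hc with rfl | rfl <;> (rw [le_abs] at h401 ⊢; push_cast; omega)
  have hgm' : ∀ t : ℝ, gm (t : UnitAddCircle) = Complex.exp (-(2 * π * I * (-(8 : ℤ)) * ((tri (2 * π * t) / (2 * π) : ℝ) : ℂ))) := by
    intro t; rw [hgm t]; push_cast; ring_nf
  have hmain := tsum_weight_sq_norm_phaseOne_le_exact ψ hb hab hW0 hW1 8 hgp hgm' hgpc hgmc hη
  -- the fibre functionals: nonnegative, at most one, and tail-small for `1 ≤ |n| ≤ 49`
  have hT : ∀ c : ℤ, (c = 1 ∨ c = -1) → ∀ n : ℤ, 1 ≤ |n| → |n| ≤ 49 →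
      ∑' p : ℤ, W (![p, n]) * ‖fourierCoeff (twist ψ n) (p + c)‖ ^ 2 ≤
        2 * (2 * |(((8 * n : ℤ)) : ℝ)| * 0.31831) ^ 2 * (((400 : ℕ) : ℝ) ^ 2 / (((400 : ℕ) : ℝ) ^ 2 - (((8 * n : ℤ)) : ℝ) ^ 2)) ^ 2 /
          (3 * (((400 : ℕ) : ℝ) - 2) * (((400 : ℕ) : ℝ) - 1) * ((400 : ℕ) : ℝ)) +
        2 * (2 * π * (|(n : ℝ)| * η₁)) := by
    intro c hc n hn1 hn2
    obtain ⟨g₀, hg₀c, hg₀⟩ := exists_exactChirp (8 * n)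
    have hnear : ∀ x, ‖twist ψ n x - g₀ x‖ ≤ 2 * π * (|(n : ℝ)| * η₁) := fun x =>
      (norm_twist_sub_exactChirp_le ψ hη n hg₀ x).trans (by
        have := mul_le_mul_of_nonneg_left hηη₁ (abs_nonneg (n : ℝ)); nlinarith [Real.pi_pos])
    have hlam : |(8 * n : ℤ)| < ((400 : ℕ) : ℤ) := by
      rw [abs_mul, show |(8 : ℤ)| = 8 by norm_num]; push_cast; omega
    have h := tsum_tail_sq_norm_twist_le ψ n hg₀ hg₀c hnear (by norm_num) hlam le_rfl
    exact (tsum_tailWeight_twist_shift_le ψ n c hW0 hW1 (hWs c hc n)).trans h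
  have h0' : ∀ (c n : ℤ), 0 ≤ ∑' p : ℤ, W (![p, n]) * ‖fourierCoeff (twist ψ n) (p + c)‖ ^ 2 :=
    fun c n => tsum_nonneg fun p => mul_nonneg (hW0 _) (sq_nonneg _)
  have h1' : ∀ (c n : ℤ), ∑' p : ℤ, W (![p, n]) * ‖fourierCoeff (twist ψ n) (p + c)‖ ^ 2 ≤ 1 :=
    fun c n => tsum_weight_chirp_le_one ψ n c hW0 hW1
  -- plus functional (`p + 1`) and minus functional (`p − 1`)
  have hp0 : ∀ n : ℤ, 0 ≤ ∑' p : ℤ, W (![p, n]) * ‖fourierCoeff (twist ψ n) (p - 1)‖ ^ 2 :=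
    fun n => by simpa [sub_eq_add_neg] using h0' (-1) n
  have hp1 : ∀ n : ℤ, ∑' p : ℤ, W (![p, n]) * ‖fourierCoeff (twist ψ n) (p - 1)‖ ^ 2 ≤ 1 :=
    fun n => by simpa [sub_eq_add_neg] using h1' (-1) n
  have hpT : ∀ n : ℤ, 1 ≤ |n| → |n| ≤ 49 →
      ∑' p : ℤ, W (![p, n]) * ‖fourierCoeff (twist ψ n) (p - 1)‖ ^ 2 ≤
        2 * (2 * |(((8 * n : ℤ)) : ℝ)| * 0.31831) ^ 2 * (((400 : ℕ) : ℝ) ^ 2 / (((400 : ℕ) : ℝ) ^ 2 - (((8 * n : ℤ)) : ℝ) ^ 2)) ^ 2 /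
          (3 * (((400 : ℕ) : ℝ) - 2) * (((400 : ℕ) : ℝ) - 1) * ((400 : ℕ) : ℝ)) +
        2 * (2 * π * (|(n : ℝ)| * η₁)) := fun n hn1 hn2 => by
    simpa [sub_eq_add_neg] using hT (-1) (Or.inr rfl) n hn1 hn2
  have hSm := exactChirp8_functional_le (Or.inr rfl) hgm hgmc (h0' 1) (h1' 1) (hT 1 (Or.inl rfl))
  have hSp := exactChirp8_functional_le (Or.inl rfl) hgp hgpc hp0 hp1 hpT
  have hsq : ∀ {x : ℝ}, x ≤ 180 / 10 ^ 6 → 0 ≤ x →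
      (Real.sqrt x + 2 * π * η) ^ 2 ≤ (Real.sqrt (180 / 10 ^ 6) + (2 : ℝ)⁻¹ ^ 25) ^ 2 := by
    intro x hx hx0
    exact pow_le_pow_left₀ (by positivity) (add_le_add (Real.sqrt_le_sqrt hx) hηs) 2
  have h1 := hsq hSm (tsum_nonneg fun n => mul_nonneg (sq_nonneg _) (h0' 1 n))
  have h2 := hsq hSp (tsum_nonneg fun n => mul_nonneg (sq_nonneg _) (hp0 n))
  have hfinal : (Real.sqrt (180 / 10 ^ 6) + (2 : ℝ)⁻¹ ^ 25) ^ 2 ≤ 181 / 10 ^ 6 := by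
    have hs : Real.sqrt (180 / 10 ^ 6) ≤ 0.0134165 := by
      rw [Real.sqrt_le_left (by norm_num)]; norm_num
    have h0 : 0 ≤ Real.sqrt (180 / 10 ^ 6) := Real.sqrt_nonneg _
    nlinarith
  linarith

end Cascade

end Summit.AnomalousDissipation.AnomalousDissipation.Theorems.SawtoothPulseCascade.K1Start
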